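import Summits.RiemannHypothesis.RiemannHypothesis.Theorems.WeilDetection
import Literature.NumberTheory.LFunctions.WeilMellinBounds
import Literature.NumberTheory.LFunctions.WeilLogLatticeComb
import Mathlib.Analysis.Calculus.Deriv.Shift
import Mathlib.Analysis.Complex.RealDeriv
import HarnessLib

/-!
# The PHASE FIXER for the Weil detection principle (TRACK «HANDOFF», handoff-prove-1 ATTEMPT-5 §3 / ATTEMPT-6 §1 (v))

`weil_detection_offline` (WeilDetection.lean) needs the phase condition `Re F̂(ρ₀)² = -‖F̂(ρ₀)‖²`
at the target zero. This file shows the condition can always be ARRANGED at no cost in support: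
given a real even test function `g` with `ĝ(ρ₀) ≠ 0` at an off-line zero `ρ₀`, either `g` itself
or `F := g'' + p₀ g` for a suitable real `p₀` (transform `((s - 1/2)² + p₀)·ĝ(s)`, the phase factor
`P(w) = w² + p₀` of ATTEMPT-5 §2 (iv)) is a real even test function with the same support bound,
the same killed zeros, `F̂(ρ₀) ≠ 0`, and the phase condition. Consequence
(`weil_detection_offline_phase`): under Weil positivity on `[-b, b]`, a real even killer of the box
`0 < Im ρ ≤ T*` minus an off-line class `{ρ₀, 1 - ρ̄₀}` with `ĝ(ρ₀) ≠ 0` forces tail mass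
`≥ 2 m(ρ₀)‖F̂(ρ₀)‖² - ε` above `T*`. Devices: realness and parity of derivatives of real even
functions; the transform of `g''` (`weilMellin_iterate_deriv`). Nothing here bears on the truth of RH.
-/

noncomputable section

set_option linter.dupNamespace false

open Complex Filter Set Topology
open scoped ComplexConjugate

namespace Summit.RiemannHypothesis.RiemannHypothesis.Theorems.WeilConverseWindow

open Literature.NumberTheory.LFunctions

/-- The derivative of a real-valued function `ℝ → ℂ` is real-valued. [folklore] -/
theorem im_deriv_eq_zero_of_real {g : ℝ → ℂ} (hre : ∀ t, (g t).im = 0) (t : ℝ) :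
    (deriv g t).im = 0 := by
  have hg : g = fun x ↦ (((g x).re : ℝ) : ℂ) :=
    funext fun x ↦ Complex.ext (by simp) (by simp [hre x])
  by_cases hd : DifferentiableAt ℝ (fun x ↦ (g x).re) t
  · have hda : HasDerivAt (fun x ↦ (((g x).re : ℝ) : ℂ)) ((deriv (fun x ↦ (g x).re) t : ℝ) : ℂ) t :=
      hd.hasDerivAt.ofReal_comp
    rw [hg, hda.deriv, Complex.ofReal_im]
  · have hnd : ¬DifferentiableAt ℝ g t := fun h ↦ hd
      ((Complex.reCLM.differentiableAt.comp t h).congr_of_eventuallyEq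
        (Filter.Eventually.of_forall fun x ↦ by simp))
    rw [deriv_zero_of_not_differentiableAt hnd, Complex.zero_im]

/-- All derivatives of a real-valued function `ℝ → ℂ` are real-valued. [folklore] -/
theorem im_iterate_deriv_eq_zero_of_real {g : ℝ → ℂ} (hre : ∀ t, (g t).im = 0) (k : ℕ) (t : ℝ) :
    ((deriv^[k] g) t).im = 0 := by
  induction k generalizing t with
  | zero => exact hre t
  | succ k ih =>
    rw [Function.iterate_succ_apply']
    exact im_deriv_eq_zero_of_real ih t

/-- The derivative of an even function is odd. [folklore] -/
theorem deriv_neg_of_even {g : ℝ → ℂ} (hev : ∀ t, g (-t) = g t) (t : ℝ) :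
    deriv g (-t) = -deriv g t := by
  have h : (fun x ↦ g (-x)) = g := funext hev
  have := deriv_comp_neg (f := g) (x := t)
  rw [h] at this
  rw [this, neg_neg]

/-- The derivative of an odd function is even. [folklore] -/
theorem deriv_neg_of_odd {g : ℝ → ℂ} (hodd : ∀ t, g (-t) = -g t) (t : ℝ) :
    deriv g (-t) = deriv g t := by
  have h : (fun x ↦ g (-x)) = -g := funext hodd
  have := deriv_comp_neg (f := g) (x := t)
  rw [h, deriv.neg] at this
  exact (neg_injective this).symm

/-- The second derivative of an even function is even. [folklore] -/
theorem deriv_deriv_even {g : ℝ → ℂ} (hev : ∀ t, g (-t) = g t) (t : ℝ) :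
    deriv (deriv g) (-t) = deriv (deriv g) t :=
  deriv_neg_of_odd (deriv_neg_of_even hev) t

/-- A purely imaginary number squares to minus its norm squared. [folklore] -/
theorem sq_re_eq_neg_norm_sq_of_re_eq_zero {u : ℂ} (hu : u.re = 0) : (u ^ 2).re = -‖u‖ ^ 2 := by
  rw [sq, Complex.mul_re, hu, Complex.sq_norm, Complex.normSq_apply, hu]
  ring

/-- **Phase fixer + detection.** Let Weil positivity hold on `[-b, b]`; let `g` be a real even test
function supported in `[-b, b]` whose transform kills every zero of the box `0 < Im ρ ≤ T*` except the
off-line class `{ρ₀, 1 - ρ̄₀}`, with `ĝ(ρ₀) ≠ 0`. Then there is a real even test function `F`,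
supported in `[-b, b]`, with `F̂(s) = ((s - 1/2)² + p₀)^d · ĝ(s)` for some real `p₀` and `d ≤ 1`
(so `F` kills the same zeros), `F̂(ρ₀) ≠ 0`, and for every `ε > 0`, for all large `T`,
`2·m(ρ₀)·‖F̂(ρ₀)‖² - ε ≤ ∑_{ρ ∈ Box(T) \ Box(T*)} m(ρ)‖F̂(ρ)‖²`. [handoff-prove-1 ATTEMPT-6 §1 (v), §2] -/
theorem weil_detection_offline_phase {b Tstar : ℝ} {g : ℝ → ℂ} (hW : WeilPositivityOn b)
    (hg : IsWeilTest g) (hsupp : tsupport g ⊆ Icc (-b) b) (hre : ∀ t, (g t).im = 0)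
    (hev : ∀ t, g (-t) = g t) {ρ₀ : ℂ} (hρ₀ : ρ₀ ∈ zetaZeroBox 0 Tstar) (hoff : ρ₀.re ≠ 1 / 2)
    (hkill : ∀ ρ ∈ zetaZeroBox 0 Tstar, ρ ≠ ρ₀ → ρ ≠ 1 - conj ρ₀ → weilMellin g ρ = 0)
    (hne : weilMellin g ρ₀ ≠ 0) :
    ∃ (p₀ : ℝ) (d : ℕ) (F : ℝ → ℂ), d ≤ 1 ∧ IsWeilTest F ∧ tsupport F ⊆ Icc (-b) b ∧
      (∀ t, (F t).im = 0) ∧ (∀ t, F (-t) = F t) ∧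
      (∀ s, weilMellin F s = ((s - 1 / 2) ^ 2 + p₀) ^ d * weilMellin g s) ∧
      weilMellin F ρ₀ ≠ 0 ∧
      ∀ ε : ℝ, 0 < ε → ∀ᶠ T in atTop,
        2 * (riemannZetaZeroOrder ρ₀ : ℝ) * ‖weilMellin F ρ₀‖ ^ 2 - ε ≤
          ∑ᶠ ρ ∈ zetaZeroBox 0 T \ zetaZeroBox 0 Tstar,
            (riemannZetaZeroOrder ρ : ℝ) * ‖weilMellin F ρ‖ ^ 2 := by
  set A : ℂ := weilMellin g ρ₀ with hA
  by_cases hAre : A.re = 0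
  · -- `ĝ(ρ₀)` is already purely imaginary: take `F = g`
    refine ⟨0, 0, g, zero_le_one, hg, hsupp, hre, hev, fun s ↦ by simp, hne, fun ε hε ↦ ?_⟩
    exact weil_detection_offline hW hg hsupp hre hev hρ₀ hoff hkill
      (sq_re_eq_neg_norm_sq_of_re_eq_zero hAre) hε
  · -- phase factor `P(w) = w² + p₀`, `w = s - 1/2`, realised by `F = g'' + p₀ g`
    set w₀ : ℂ := ρ₀ - 1 / 2 with hw₀
    set p₀ : ℝ := (w₀ ^ 2).im * A.im / A.re - (w₀ ^ 2).re with hp₀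
    set F : ℝ → ℂ := fun t ↦ deriv (deriv g) t + (p₀ : ℂ) * g t with hF
    have hg2 : IsWeilTest (deriv (deriv g)) := hg.deriv.deriv
    have hFtest : IsWeilTest F := hg2.add (hg.const_mul (p₀ : ℂ))
    have hsupp2 : tsupport (deriv (deriv g)) ⊆ tsupport g :=
      tsupport_deriv_subset.trans tsupport_deriv_subset
    have hsuppc : tsupport (fun t ↦ (p₀ : ℂ) * g t) ⊆ tsupport g :=
      closure_mono (Function.support_mul_subset_right _ _)
    have hFsupp : tsupport F ⊆ Icc (-b) b :=
      ((tsupport_add _ _).trans (union_subset hsupp2 hsuppc)).trans hsupp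
    have hFre : ∀ t, (F t).im = 0 := fun t ↦ by
      have h2 := im_iterate_deriv_eq_zero_of_real hre 2 t
      simp only [Function.iterate_succ, Function.iterate_zero, Function.comp_apply, id_eq] at h2
      simp [hF, Complex.add_im, Complex.mul_im, hre t, h2]
    have hFev : ∀ t, F (-t) = F t := fun t ↦ by
      simp only [hF, deriv_deriv_even hev t, hev t]
    have hFmellin : ∀ s, weilMellin F s = ((s - 1 / 2) ^ 2 + p₀) * weilMellin g s := fun s ↦ by
      have h2 := weilMellin_iterate_deriv hg 2 s
      simp only [Function.iterate_succ, Function.iterate_zero, Function.comp_apply, id_eq] at h2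
      rw [hF, show (fun t ↦ deriv (deriv g) t + (p₀ : ℂ) * g t) =
          (deriv (deriv g)) + (fun t ↦ (p₀ : ℂ) * g t) from rfl,
        weilMellin_add hg2.1.continuous hg2.2 (hg.const_mul (p₀ : ℂ)).1.continuous
          (hg.const_mul (p₀ : ℂ)).2, h2, weilMellin_const_mul]
      ring
    -- the value at the target is purely imaginary and non-zero
    have hc_im : ((w₀ ^ 2 + p₀ : ℂ)).im = (w₀ ^ 2).im := by simp
    have hc_re : ((w₀ ^ 2 + p₀ : ℂ)).re = (w₀ ^ 2).im * A.im / A.re := by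
      simp [hp₀]
    have hFρ₀ : weilMellin F ρ₀ = (w₀ ^ 2 + p₀) * A := by rw [hFmellin, hw₀, hA]
    have hre0 : (weilMellin F ρ₀).re = 0 := by
      rw [hFρ₀, Complex.mul_re, hc_re, hc_im]
      field_simp
      ring
    have hw2 : (w₀ ^ 2).im ≠ 0 := by
      have him0 : 0 < ρ₀.im := hρ₀.2.2.2.1
      have : (w₀ ^ 2).im = 2 * (ρ₀.re - 1 / 2) * ρ₀.im := by
        simp [hw₀, sq, Complex.mul_im]; ring
      rw [this]
      exact mul_ne_zero (mul_ne_zero two_ne_zero (sub_ne_zero.2 hoff)) him0.ne'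
    have hc_ne : (w₀ ^ 2 + (p₀ : ℂ)) ≠ 0 := fun h ↦ hw2 (by
      have := congrArg Complex.im h
      simpa using this)
    have hFne : weilMellin F ρ₀ ≠ 0 := by rw [hFρ₀]; exact mul_ne_zero hc_ne hne
    have hFkill : ∀ ρ ∈ zetaZeroBox 0 Tstar, ρ ≠ ρ₀ → ρ ≠ 1 - conj ρ₀ → weilMellin F ρ = 0 :=
      fun ρ hρ h1 h2 ↦ by rw [hFmellin, hkill ρ hρ h1 h2, mul_zero]
    refine ⟨p₀, 1, F, le_rfl, hFtest, hFsupp, hFre, hFev, fun s ↦ by rw [pow_one, hFmellin],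
      hFne, fun ε hε ↦ ?_⟩
    exact weil_detection_offline hW hFtest hFsupp hFre hFev hρ₀ hoff hFkill
      (sq_re_eq_neg_norm_sq_of_re_eq_zero hre0) hε

end Summit.RiemannHypothesis.RiemannHypothesis.Theorems.WeilConverseWindow

end
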